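import Mathlib
import HarnessLib
import Literature.NumberTheory.LFunctions.HorocycleRH
import Literature.NumberTheory.LFunctions.HorocycleRateHalf
import Literature.NumberTheory.LFunctions.HorocycleRateHalfArcBound
import Literature.NumberTheory.LFunctions.HorocycleRateHalfUnfolding

/-!
# Proof of the unconditional rate `O(y^{1/2})` for closed horocycles on `SL(2,ℤ)\ℍ`

Discharge of the named fact `Literature.NumberTheory.LFunctions.zagier_horocycle_rate_half`
(`HorocycleRH.lean`; Sarnak 1981, Thm. 1; Zagier 1981, §1 p. 279): for every `F : ℂ → ℂ`
smooth on `{im > 0}`, `SL(2,ℤ)`-invariant on `ℍ` and vanishing on `𝒟 ∩ {im > Y}`, there is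
`c` with `∫₀¹ F(x+iy) dx - c = O(y^{1/2})` as `y → 0⁺`.

The proof is the elementary one organised in `HorocycleRateHalf.lean` (assembly
`zagier_horocycle_rate_half_of` from two named technical facts) with both facts now proved:
* `horocycleUnfolding_holds` (`HorocycleRateHalfUnfolding.lean`): partition of unity by the
  incomplete Eisenstein series `E₀ = ∑ χ₀(im γz) ≥ 1` and unfolding of `Γ∞\Γ/Γ∞` on the
  closed horocycle, `∫₀¹ F(x+iy) dx = 2y ∑_{c ≤ N} ∑*_{a mod c} Φ_f(c²y, a/c)`;
* `arcFourierBound_holds` (`HorocycleRateHalfArcBound.lean`): the Fourier expansion of the arc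
  transform `Φ_f(w, ·)` with coefficients `O(|k|⁻³)` uniformly in `w` (one integration by parts
  in the unfolded variable against the phase `t/(w(1+t²))`, `HorocyclePhase.lean`) and the smooth
  zero-mode profile (`HorocycleZeroKernel.lean`);
together with the tree's `CoprimeResidueSums.norm_sum_coprime_sub_le` (Ramanujan sums) and
`HorocycleZeroMode.zeroMode_bound` (`∑ (φ(c)/c) k(lc) = (6/π²)(∫k)/l + O(1)`).
In particular the argument uses neither the spectral decomposition of `L²(Γ\ℍ)` nor the
meromorphic continuation of `E(z,s)`; the constant is `c = 2 (∑_d μ(d)/d²) ∫₀² k₀`.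

The two named technical facts are discharged by bridging to the files landed for the textually
identical twin fact `zagier_sarnak_horocycle_rate_half` (`HorocyclePhase.lean`,
`HorocycleUnfolding.lean`, `HorocycleZeroKernel.lean`; its own discharge is
`HorocycleEquidistributionProofs.lean`), plus the partition of unity of
`HorocycleRateHalfUnfolding.lean`.

## References
* P. Sarnak, *Asymptotic behavior of periodic orbits of the horocycle flow and Eisenstein
  series*, Comm. Pure Appl. Math. 34 (1981), 719–739, Thm. 1 [Sarnak1981].
* D. Zagier, *Eisenstein series and the Riemann zeta function*, in: Automorphic forms,
  representation theory and arithmetic (Bombay 1979), Springer 1981, 275–301, §1 [Zagier1981].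
* H. Iwaniec, *Spectral Methods of Automorphic Forms*, 2nd ed., AMS GSM 53 (2002), §2.4, §3.4
  [Iwaniec2002].
-/

noncomputable section

namespace Literature.NumberTheory.LFunctions

/-- **Sarnak 1981, Thm. 1 / Zagier 1981, §1 (unconditional half-power rate), PROVED**:
discharge of the named fact `zagier_horocycle_rate_half` by the elementary unfolding proof
(`zagier_horocycle_rate_half_of` with `horocycleUnfolding_holds` and `arcFourierBound_holds`).
[cite: Sarnak1981, Thm. 1] -/
theorem zagier_horocycle_rate_half_holds : zagier_horocycle_rate_half :=
  zagier_horocycle_rate_half_of horocycleUnfolding_holds arcFourierBound_holds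

/-- **`HorocycleRate (1/2)` unconditionally**: closed horocycles on `SL(2,ℤ)\ℍ` equidistribute
with rate `O_ε(y^{1/2-ε})` for every `ε > 0` — `horocycleRate_half_of` (`HorocycleRH.lean`)
applied to `zagier_horocycle_rate_half_holds`; the lower endpoint `θ = 1/2` of Zagier's
dictionary `HorocycleRate θ ↔ QuasiRH (2 - 2θ)`. Real proof.
[cite: Sarnak1981, Thm. 1] [cite: Zagier1981, §1 (8) and p. 279] -/
theorem horocycleRate_half : HorocycleRate (1 / 2) :=
  horocycleRate_half_of zagier_horocycle_rate_half_holds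

end Literature.NumberTheory.LFunctions

end
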